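import Summits.QuantumFields.QCD.Theses.EulerDescent
import HarnessLib.Audit

/-!
# Birth skeleton (BC3) for the crux `HonestHeavyAnchor` (item stmt-QuantumFields-16901)

Route `EulerDescent` (sub-problem QCD), crux decl
`Summit.QuantumFields.QCD.Theses.EulerDescent.HonestHeavyAnchor` (rank 3, open-problem):

  for `N_f ∈ {2,3}` there are a regularisation `reg`, a corner sequence `mc` and `M_h > 0` with
  (corner) eventually `mc k` is the least upper bound of the NON-MASSIVE degenerate bare Wilson masses at `β_k`;
  (pin) `(reg.mcrit k − mc k)·Z_m(k)/a_k → 0`; `reg.HasMassScaling`; `(reg.scheme 0 0 0).HasAsymptoticScaling`;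
  (branch) eventually `−1 < reg.mcrit k`; `0 < M_h`; and (heavy body) for every tuple with all `m_f ≥ M_h` there are
  species renormalisations and OS data with `IsQCDAlong`, non-trivial non-Gaussian glue, dynamical flavour-changing
  pseudoscalars and one `Δ > 0` with `T.HasMassGap Δ ∧ HasLatticeMassGap Δ`
  — "the threshold body of the heavy-threshold family for an HONESTLY PINNED regularisation".

Registered by the skeleton-registrar seat `planner-skel-stmt-QuantumFields-16901-0` (route re-audit bin REPAIRABLE,
2026-08-17) as `Cruxes/HonestHeavyAnchor/Lines/birth.lean`.  It is the route-level BIRTH CERTIFICATE of the crux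
(≥ 2 named stubs, a kernel-checked composition concluding the crux BY NAME, `sorry` only inside `stub_*`), cut along
the route header's OWN two-layer plan for this node — "HonestHeavyAnchor ⇐ the heavy-threshold family's
ConstructiveDecouplingRG-type node + CornerPin (the flow-tuned critical mass IS the intrinsic corner to o(a/Z_m))" —
with ONE stub per clause of the crux's recorded why-it-might-fail line ("contains robust SU(3) Yang–Mills via
decoupling" / "IsLUB needs the YM sector at β_k to cluster for all heavy masses" / "the pin asks m_crit to o(a/Z_m),
beyond the O(aΛ) renormalon ambiguity"):

* `stub_heavyThresholdAnchor : Stmt.stub_heavyThresholdAnchor` — VERBATIM the statement of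
  `HeavyThresholdYMBridge.ThresholdQCD`, item stmt-QuantumFields-8794 (the TARGET of route HeavyThresholdYMBridge = the
  output of its ConstructiveDecouplingRG node; shared in substance by NestedDissectionSea / RenormalisedVafaWitten /
  SeaNonGibbs' SeaThreshold; restated, not imported, so that this file depends on `Theses.EulerDescent` only — same
  normalised signature).  The UNPINNED heavy-threshold anchor: for `N_f ∈ {2,3}` some `M₀ ≥ 0` and ONE mass-scaling
  regularisation carrying the full heavy body at every tuple above `M₀`.  Yang–Mills-hard (contains the SU(3)
  glueball gap along asymptotically free sequences via decoupling); open-problem.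
* `stub_intrinsicCorner : Stmt.stub_intrinsicCorner` — THE INTRINSIC WILSON CORNER AT WEAK COUPLING (lattice phase
  structure; a ∀-law over regularisations, reading only `β_k, a_k`): along every asymptotically scaling sequence
  (`β_k − afBeta N_f Λ a_k → 0`, so `β_k → ∞`), EVENTUALLY the set of non-massive degenerate bare Wilson masses at `β_k`
  is non-empty and bounded above — so its least upper bound `m_c(β_k)`, the intrinsic critical bare mass, exists —
  and `m_c(β_k) → 0` (the critical hopping parameter tends to its tree value `1/8`).  Bounded-above IS "lattice QCD at
  (β_k, μ) is massive for all heavy μ", i.e. the pure-gauge sector at the fixed weak coupling `β_k` clusters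
  (lattice Yang–Mills gap at fixed large β — open); non-empty is the chiral transition point on the Wilson axis
  (Aoki edge with a massless pion, or Sharpe–Singleton first-order coexistence); open-problem.
* `stub_cornerOffset : Stmt.stub_cornerOffset` — THE PIN PROPER (renormalisation theory of Wilson fermions; a
  ∀-law): for `N_f ∈ {2,3}`, every mass-scaling regularisation that carries the heavy body above SOME threshold
  (honest continuum limits with DYNAMICAL quarks along the FULL sequence) and whose couplings have an intrinsic corner
  `mc` has its flow-tuned critical mass at a CONVERGENT renormalised offset from the corner:
  `(reg.mcrit k − mc k)·Z_m(k)/a_k → M₀ ∈ ℝ`.  Non-decoupling (`IsNontrivial (pseudoRe f g)`) bounds the offset,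
  full-sequence convergence of the hadron correlators forbids two subsequential offsets — GIVEN that continuum QCD
  correlators separate RGI quark masses (only the SIGN of `∂M/∂m` is known: QCD mass inequalities); size L / open.

`HonestHeavyAnchor_of : Stmt.stub_heavyThresholdAnchor → Stmt.stub_intrinsicCorner → Stmt.stub_cornerOffset →
HonestHeavyAnchor` is kernel-checked and NOT modus ponens: the anchor gives `(M₁, reg, body)`; asymptotic scaling is
READ OFF the body (`IsQCDAlong` at the tuple `M₁ + 1`; the clause reads only `β, a`); the corner law gives `(mc, mc → 0)`;
the offset law gives `M₀`; the witness is the RE-PINNED regularisation `repin reg M₀ = {reg with mcrit := m_crit(k) −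
a_k M₀/Z_m(k)}` with the SAME corner `mc` and threshold `M₁ + |M₀| + 1`: corner / mass scaling / asymptotic scaling are
untouched (`β, a, Z_m` unchanged — definitional), the pin is `offset − M₀ → 0` (`cornerOffset_repin`, exact algebra), the
physical branch follows from `repinned m_crit = mc + (a/Z_m)·(offset − M₀) → 0 + 0·0` (`repin_mcrit_eq`,
`tendsto_a_div_Zm` — `a_k/Z_m(k) → 0` PROVED from `HasMassScaling`, `a_k → 0` and `γ₀/(2β₀) ≥ 0` for `N_f = 2, 3`,
`massExponent_nonneg`), and the heavy body is transported by the scheme identity `(repin reg M₀).scheme m = reg.scheme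
(m − M₀)` (`scheme_repin`; the landed `GluonicCompletion.Negative.scheme_mcrit_shift` with `−M₀`).
`honestHeavyAnchor_of_stubs : HonestHeavyAnchor` instantiates it.

## Negative knowledge honoured (read 2026-08-17)
* `ledger crux ls stmt-QuantumFields-16901`: NO workfiles before this one (no `Disproof.lean`, no `_false_without_`
  theorems, no ideas, no dead lines, no landed `Theorems/HonestHeavyAnchor/Negative/*`): none relevant.
* `ledger negatives --problem QuantumFields` (5 entries: RobustYangMillsRG stmt-14958 — a wild blocking map inhabits an
  under-constrained admissibility predicate; MirrorModularBoosts DiagonalMirrorRP stmt-9665; AdaptiveCoarseSystem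
  stmt-9494; MultibosonLatticeGap stmt-9599 — an unsatisfiable bespoke admissibility clause; AdmissibleRootsExist
  stmt-9603).  Lesson applied: NO bespoke admissibility predicate is introduced — the three stubs are typed over the
  Statement's own vocabulary (`QCDRegularisation`, `HasMassScaling`, `HasAsymptoticScaling`, `IsQCDAlong`,
  `HasLatticeMassGap`, `qcdLatticeConnectedCorr`, `QCDLatticeObservable`) and the crux's own inlined corner set; the one
  named currency `NonMassive N_f β` IS that set, `IsCorner` / `cornerOffset` / `BodyAbove` are the crux's clauses.
* The threshold-shift symmetry (`massiveBody_iff_threshold`, formerly `qcdOf_iff_threshold`; the re-type of 2026-08-16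
  killed it as a route closer) is used here only INSIDE the crux, to move the anchor's `m_crit` onto the corner — the
  crux's pin clause is exactly what removes the shift freedom, and the skeleton makes the offset `M₀` an OUTPUT of
  stub 3, not a choice.
* Junk witnesses: the vacuum data with `z ≡ 0` inhabit `IsQCDAlong` (`isQCDAlong_zeroAF_vacuum`) but NOT the
  non-decoupling clause of `BodyAbove`, so the hypothesis of stub 3 is not junk-inhabited; the corner `mc` of a given
  `reg` is eventually UNIQUE (`IsLUB`), so stub 3 has no freedom in `mc`; typing checklist 4c: no Bochner integral over a
  free function, no hand-picked threshold or rate (`M₀, M₁, Δ` existential / universally supplied), no determinantal or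
  complex-action positivity claim.

## BC3 probes (planner folder `bc/`): for each stub statement `X` and each `Y ∈ {HonestHeavyAnchor, QCD}`,
`X → Y` by `first | exact? | simpa [X] | (unfold X; simpa) | aesop` and by each alternative alone MUST FAIL (files
`bc/probe_<stub>_{crux,summit}.lean`, statements copied verbatim with no stub or composition in scope; rc and goals
in the seat's NOTES.md and in `Lines/birth.md`).
-/

noncomputable section

namespace Summit.QuantumFields.QCD.Cruxes.HonestHeavyAnchor.Birth

open scoped Topology
open Filter
open Literature.MathematicalPhysics.QuantumFieldTheory
open Summit.QuantumFields.QCD.Theses.EulerDescent (HonestHeavyAnchor)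

variable {Nf : ℕ}

/-! ## §0 Currency (the crux's own clauses, named) -/

variable (Nf) in
/-- **The NON-MASSIVE degenerate bare Wilson masses at inverse coupling `β`** (the crux's inlined set, verbatim):
those `μ` at which lattice QCD with `N_f` degenerate flavours of bare mass `μ` at coupling `β` is NOT massive — some
pair of gauge-invariant local observables fails to cluster exponentially in Euclidean time at any lattice rate
uniformly in the torus side `2S+1`. -/
def NonMassive (β : ℝ) : Set ℝ :=
  {μ : ℝ | ¬ (∀ (R R' : ℕ) (A : QCDLatticeObservable Nf R) (B : QCDLatticeObservable Nf R'),
    ∃ (C δ : ℝ) (S₀ : ℕ), 0 < δ ∧ ∀ S : ℕ, S₀ ≤ S → ∀ n : ℕ, n ≤ S →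
      ‖qcdLatticeConnectedCorr β (2 * S + 1) (fun _ : Fin Nf => μ) A B n‖ ≤ C * Real.exp (-(δ * n)))}

/-- **`mc` is (eventually) the INTRINSIC WILSON CORNER of `reg`**: for all large `k`, `mc k` is the least upper bound
of the non-massive degenerate bare masses at `β_k` (the crux's corner clause; it reads only `reg.β`). -/
def IsCorner (reg : QCDRegularisation Nf) (mc : ℕ → ℝ) : Prop :=
  ∀ᶠ k in atTop, IsLUB (NonMassive Nf (reg.β k)) (mc k)

/-- **The renormalised corner offset** of `reg` against the corner sequence `mc` at step `k`:
`(m_crit(k) − mc(k))·Z_m(k)/a_k` — the RGI mass by which `reg`'s flow-tuned critical mass misses the intrinsic corner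
(the crux's pin clause is `cornerOffset reg mc → 0`). -/
def cornerOffset (reg : QCDRegularisation Nf) (mc : ℕ → ℝ) (k : ℕ) : ℝ :=
  (reg.mcrit k - mc k) * reg.Zm k / reg.a k

/-- **The heavy body of `reg` above the threshold `M`** (verbatim the consequent of `ThresholdQCD` / of the crux's
last clause, strict form): every tuple with all `m_f > M` carries species renormalisations, OS data with `IsQCDAlong`,
non-trivial non-Gaussian glue, dynamical flavour-changing pseudoscalars and ONE `Δ > 0` for
`T.HasMassGap Δ ∧ HasLatticeMassGap Δ`. -/
def BodyAbove (reg : QCDRegularisation Nf) (M : ℝ) : Prop :=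
  ∀ m : Fin Nf → ℝ, (∀ f, M < m f) →
    ∃ (z shift : QCDField Nf → ℕ → ℝ) (T : OSData (QCDField Nf) 4),
      IsQCDAlong (reg.scheme m z shift) T ∧ T.IsNontrivial QCDField.glue ∧
        T.IsNonGaussian QCDField.glue ∧
          (∀ f g : Fin Nf, f ≠ g → T.IsNontrivial (QCDField.pseudoRe f g)) ∧
            ∃ Δ > 0, T.HasMassGap Δ ∧ (reg.scheme m z shift).HasLatticeMassGap Δ

/-! ## §1 The three stub statements

Naming (for `ledger skeleton check` / `#h21_check_skeleton`): the statement of the registered stub `stub_<name>` is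
`def Stmt.stub_<name> : Prop`, so that every hypothesis of the composition `HonestHeavyAnchor_of` is headed by a
constant whose short name IS a declared stub. -/

/-- **(S1) The UNPINNED heavy-threshold anchor** — VERBATIM the statement of `HeavyThresholdYMBridge.ThresholdQCD`
(item stmt-QuantumFields-8794, the target of the heavy-threshold family = the output of its ConstructiveDecouplingRG node;
restated rather than imported so that this skeleton elaborates against `Theses.EulerDescent` alone — the two `Prop`s are
syntactically identical, `Iff.rfl` in any file importing both, and the gate identifies them by normalised signature):
for `N_f ∈ {2,3}` there are `M₀ ≥ 0` and ONE mass-independent regularisation `reg` with `HasMassScaling` such that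
every tuple with all `m_f > M₀` carries species renormalisations, OS data `T` with `IsQCDAlong (reg.scheme m z shift) T`,
non-trivial non-Gaussian glue, `IsNontrivial (pseudoRe f g)` for `f ≠ g`, and one `Δ > 0` with `T.HasMassGap Δ ∧
(reg.scheme m z shift).HasLatticeMassGap Δ`.  NO pin, NO corner: the additive mass renormalisation of this `reg` is
free up to a flavour-blind RGI offset (`massiveBody_iff_threshold`).  Why it might fail: contains the SU(3)
Yang–Mills glueball gap along asymptotically free sequences (decoupling, AppelquistCarazzone1975) and the
heavy-quark lattice/continuum construction (Balaban1988Convergent, BalabanOcarrollSchor1989) — open-problem. -/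
def Stmt.stub_heavyThresholdAnchor : Prop :=
  ∀ Nf : ℕ, Nf = 2 ∨ Nf = 3 → ∃ M₀ : ℝ, 0 ≤ M₀ ∧ ∃ reg : QCDRegularisation Nf, reg.HasMassScaling ∧
    ∀ m : Fin Nf → ℝ, (∀ f, M₀ < m f) →
      ∃ (z shift : QCDField Nf → ℕ → ℝ) (T : OSData (QCDField Nf) 4),
        IsQCDAlong (reg.scheme m z shift) T ∧ T.IsNontrivial QCDField.glue ∧
          T.IsNonGaussian QCDField.glue ∧
            (∀ f g : Fin Nf, f ≠ g → T.IsNontrivial (QCDField.pseudoRe f g)) ∧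
              ∃ Δ > 0, T.HasMassGap Δ ∧ (reg.scheme m z shift).HasLatticeMassGap Δ

/-- **(S2) The intrinsic Wilson corner at weak coupling** (lattice phase structure of degenerate Wilson QCD; reads
only `β_k, a_k`): for `N_f ∈ {2,3}` and every regularisation whose bare coupling scales asymptotically (two-loop
`afBeta` profile, hence `β_k → ∞` as `a_k → 0`) there is a sequence `mc` which is EVENTUALLY the least upper bound of
the non-massive degenerate bare masses at `β_k` (the set is non-empty — the chiral transition point of the Wilson
axis: Aoki edge / Sharpe–Singleton first-order coexistence — and bounded above — lattice QCD at `(β_k, μ)` is massive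
for all heavy `μ`, i.e. the pure-gauge sector at the FIXED weak coupling `β_k` clusters exponentially, by the
convergent hopping expansion around it) and which tends to `0` (`κ_c(β) → 1/8`: one-loop `a m_c = −0.434 g₀² + …`,
MontvayMunster1994 §5.1).  Why it might fail: bounded-above IS the lattice Yang–Mills gap at fixed large β (no
proof beyond strong coupling); in the first-order scenario the `(−1)^F`-twisted signed torus functional must still
fail to cluster at coexistence; a lattice-artefact non-massive point above the chiral corner would spoil `mc → 0`.
Size: open-problem (YM-at-finite-β-hard). -/
def Stmt.stub_intrinsicCorner : Prop :=
  ∀ Nf : ℕ, Nf = 2 ∨ Nf = 3 → ∀ reg : QCDRegularisation Nf, (reg.scheme 0 0 0).HasAsymptoticScaling →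
    ∃ mc : ℕ → ℝ, IsCorner reg mc ∧ Tendsto mc atTop (𝓝 0)

/-- **(S3) Convergent corner offset — THE PIN PROPER** (renormalisation of the Wilson critical mass beyond the
`O(aΛ)` ambiguity): for `N_f ∈ {2,3}`, every MASS-SCALING regularisation `reg` whose couplings have the intrinsic
corner `mc` (eventually) and which carries the heavy body above SOME real threshold `M` has
`(reg.mcrit k − mc k)·Z_m(k)/a_k → M₀` for some real `M₀`.  Why plausibly true: the RGI masses realised at the tuple `m`
are `cornerOffset k + κ m_f (1 + o(1))` (MontvayMunster1994 (5.91), `m_q = Z_m(m₀ − m_c)/a`); a subsequence with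
`cornerOffset → +∞` decouples every quark and kills `IsNontrivial (pseudoRe f g)`; `→ −∞` leaves the physical branch /
enters the flavour-parity-broken or doubler region (excluded by `IsQCDAlong`'s `m_f(k) > −1` and again by decoupling
of NEGATIVE-mass quarks); two distinct finite subsequential offsets give two different continuum theories at the
same tuple, against FULL-sequence convergence in `IsQCDAlong`.  Why it might fail: the last step needs "continuum
QCD Schwinger functions on off-diagonal tensors SEPARATE the RGI quark mass" (strict mass dependence of some hadron
correlator — only the sign of `∂M/∂m` is available, NussinovLampert2002; SharpeSingleton1998 for the corner's
scenario dependence).  Size: L / open. -/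
def Stmt.stub_cornerOffset : Prop :=
  ∀ Nf : ℕ, Nf = 2 ∨ Nf = 3 → ∀ (reg : QCDRegularisation Nf) (mc : ℕ → ℝ) (M : ℝ),
    reg.HasMassScaling → IsCorner reg mc → BodyAbove reg M →
      ∃ M₀ : ℝ, Tendsto (cornerOffset reg mc) atTop (𝓝 M₀)

/-! ## §2 The registered stubs (the ONLY `sorry`s of this file) -/

/-- (S1) the unpinned heavy-threshold anchor (verbatim `ThresholdQCD`, stmt-QuantumFields-8794) — open-problem. -/
theorem stub_heavyThresholdAnchor : Stmt.stub_heavyThresholdAnchor := by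
  sorry

/-- (S2) the intrinsic Wilson corner at weak coupling — open-problem. -/
theorem stub_intrinsicCorner : Stmt.stub_intrinsicCorner := by
  sorry

/-- (S3) convergent corner offset (the pin proper) — size L / open. -/
theorem stub_cornerOffset : Stmt.stub_cornerOffset := by
  sorry

/-! ## §3 Glue lemmas (proved; no `sorry` below this line) -/

/-- **Re-pinning the flavour-blind critical mass by the RGI offset `M₀`**: `m_crit(k) ↦ m_crit(k) − a_k M₀ / Z_m(k)`,
all other data of `reg` untouched. [cite: MontvayMunster1994, §5.1] -/
def repin (reg : QCDRegularisation Nf) (M₀ : ℝ) : QCDRegularisation Nf :=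
  { reg with mcrit := fun k => reg.mcrit k - reg.a k * M₀ / reg.Zm k }

/-- Re-pinning never touches `HasMassScaling` (which reads only `a_k`, `Z_m(k)`): definitional. [folklore] -/
theorem hasMassScaling_repin_iff (reg : QCDRegularisation Nf) (M₀ : ℝ) :
    (repin reg M₀).HasMassScaling ↔ reg.HasMassScaling :=
  Iff.rfl

/-- Re-pinning never touches the corner clause (which reads only `β_k`): definitional. [folklore] -/
theorem isCorner_repin_iff (reg : QCDRegularisation Nf) (M₀ : ℝ) (mc : ℕ → ℝ) :
    IsCorner (repin reg M₀) mc ↔ IsCorner reg mc :=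
  Iff.rfl

/-- Asymptotic scaling of a regularisation's scheme reads only `β_k, a_k` — neither the masses nor the species
renormalisations: definitional. [folklore] -/
theorem hasAsymptoticScaling_scheme_iff (reg : QCDRegularisation Nf) (m m' : Fin Nf → ℝ)
    (z shift z' shift' : QCDField Nf → ℕ → ℝ) :
    (reg.scheme m z shift).HasAsymptoticScaling ↔ (reg.scheme m' z' shift').HasAsymptoticScaling :=
  Iff.rfl

/-- … nor the critical mass: definitional. [folklore] -/
theorem hasAsymptoticScaling_repin_iff (reg : QCDRegularisation Nf) (M₀ : ℝ) (m : Fin Nf → ℝ)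
    (z shift : QCDField Nf → ℕ → ℝ) :
    ((repin reg M₀).scheme m z shift).HasAsymptoticScaling ↔ (reg.scheme m z shift).HasAsymptoticScaling :=
  Iff.rfl

/-- **Running the re-pinned regularisation at masses `m` IS running the original one at `m − M₀`** (the landed
`GluonicCompletion.Negative.scheme_mcrit_shift` with `−M₀`; re-proved here to keep the skeleton's imports minimal). -/
theorem scheme_repin (reg : QCDRegularisation Nf) (M₀ : ℝ) (m : Fin Nf → ℝ)
    (z shift : QCDField Nf → ℕ → ℝ) :
    (repin reg M₀).scheme m z shift = reg.scheme (fun f => m f - M₀) z shift := by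
  simp only [QCDRegularisation.scheme, repin, QCDScheme.mk.injEq, true_and, and_true]
  funext f k
  ring

/-- The corner offset of the re-pinned regularisation is the old offset minus `M₀` (exact algebra, `a_k, Z_m(k) ≠ 0`). -/
theorem cornerOffset_repin (reg : QCDRegularisation Nf) (M₀ : ℝ) (mc : ℕ → ℝ) (k : ℕ) :
    cornerOffset (repin reg M₀) mc k = cornerOffset reg mc k - M₀ := by
  have ha : reg.a k ≠ 0 := (reg.a_pos k).ne'
  have hZ : reg.Zm k ≠ 0 := (reg.Zm_pos k).ne'
  simp only [cornerOffset, repin]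
  field_simp
  ring

/-- The re-pinned critical mass in terms of the corner and the offset:
`m_crit'(k) = mc(k) + (a_k/Z_m(k))·(cornerOffset k − M₀)`. -/
theorem repin_mcrit_eq (reg : QCDRegularisation Nf) (M₀ : ℝ) (mc : ℕ → ℝ) (k : ℕ) :
    (repin reg M₀).mcrit k = mc k + reg.a k / reg.Zm k * (cornerOffset reg mc k - M₀) := by
  have ha : reg.a k ≠ 0 := (reg.a_pos k).ne'
  have hZ : reg.Zm k ≠ 0 := (reg.Zm_pos k).ne'
  simp only [cornerOffset, repin]
  field_simp
  ring

/-- The pin clause of the re-pinned regularisation, in the crux's literal form, from a convergent offset. -/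
theorem pin_repin (reg : QCDRegularisation Nf) (M₀ : ℝ) (mc : ℕ → ℝ)
    (hoff : Tendsto (cornerOffset reg mc) atTop (𝓝 M₀)) :
    Tendsto (fun k => ((repin reg M₀).mcrit k - mc k) * (repin reg M₀).Zm k / (repin reg M₀).a k)
      atTop (𝓝 0) := by
  have h : Tendsto (fun k => cornerOffset reg mc k - M₀) atTop (𝓝 (M₀ - M₀)) := hoff.sub_const M₀
  rw [sub_self] at h
  refine h.congr' (Eventually.of_forall fun k => ?_)
  exact (cornerOffset_repin reg M₀ mc k).symm

/-- The one-loop beta coefficient is positive for `N_f = 2, 3` (asymptotic freedom). [folklore] -/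
theorem betaCoeff₀_pos (hNf : Nf = 2 ∨ Nf = 3) : 0 < betaCoeff₀ Nf := by
  rcases hNf with rfl | rfl <;> norm_num [betaCoeff₀] <;> positivity

/-- The leading-log mass exponent `γ₀/(2β₀)` is non-negative for `N_f = 2, 3`. [folklore] -/
theorem massExponent_nonneg (hNf : Nf = 2 ∨ Nf = 3) : 0 ≤ massExponent Nf := by
  have hb : 0 < betaCoeff₀ Nf := betaCoeff₀_pos hNf
  unfold massExponent gammaCoeff₀
  positivity

/-- **`a_k / Z_m(k) → 0`** for a mass-scaling regularisation with non-negative mass exponent: `Z_m(k) ≍ c (log a_k⁻²)^γ`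
with `c > 0`, `γ ≥ 0` is eventually `≥ c/2`, and `a_k → 0`. [folklore] -/
theorem tendsto_a_div_Zm (reg : QCDRegularisation Nf) (hms : reg.HasMassScaling)
    (hγ : 0 ≤ massExponent Nf) : Tendsto (fun k => reg.a k / reg.Zm k) atTop (𝓝 0) := by
  obtain ⟨c, hc, hZ⟩ := hms
  -- `1/a_k² → +∞`, hence `log (1/a_k²) → +∞`
  have h1 : Tendsto (fun k => 1 / reg.a k ^ 2) atTop atTop := by
    have ha2 : Tendsto (fun k => reg.a k ^ 2) atTop (𝓝[>] 0) := by
      refine tendsto_nhdsWithin_iff.2 ⟨?_, Eventually.of_forall fun k => pow_pos (reg.a_pos k) 2⟩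
      simpa using reg.tendsto_a.pow 2
    simpa [one_div, Function.comp_def] using tendsto_inv_nhdsGT_zero.comp ha2
  have hL : Tendsto (fun k => Real.log (1 / reg.a k ^ 2)) atTop atTop := Real.tendsto_log_atTop.comp h1
  -- eventually `(log (1/a_k²))^γ ≥ 1` and `Z_m(k)/(log (1/a_k²))^γ > c/2`, so `Z_m(k) ≥ c/2`
  have hLγ : ∀ᶠ k in atTop, 1 ≤ Real.log (1 / reg.a k ^ 2) ^ massExponent Nf := by
    filter_upwards [hL.eventually_ge_atTop 1] with k hk
    exact Real.one_le_rpow hk hγ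
  have hZ2 : ∀ᶠ k in atTop, c / 2 < reg.Zm k / Real.log (1 / reg.a k ^ 2) ^ massExponent Nf :=
    hZ.eventually_const_lt (by linarith)
  have hZm : ∀ᶠ k in atTop, c / 2 ≤ reg.Zm k := by
    filter_upwards [hLγ, hZ2] with k h1 h2
    have hpos : 0 < Real.log (1 / reg.a k ^ 2) ^ massExponent Nf := by linarith
    rw [lt_div_iff₀ hpos] at h2
    nlinarith [h2, h1, hc]
  -- squeeze `0 ≤ a_k/Z_m(k) ≤ a_k/(c/2) → 0`
  have hg : Tendsto (fun k => reg.a k / (c / 2)) atTop (𝓝 0) := by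
    simpa using reg.tendsto_a.div_const (c / 2)
  refine squeeze_zero' (Eventually.of_forall fun k => (div_pos (reg.a_pos k) (reg.Zm_pos k)).le) ?_ hg
  filter_upwards [hZm] with k hk
  exact div_le_div_of_nonneg_left (reg.a_pos k).le (by linarith) hk

/-- **The physical branch of the re-pinned regularisation**: if the corner closes (`mc → 0`), the offset converges
to `M₀` and `a_k/Z_m(k) → 0`, then the re-pinned critical mass `mc + (a/Z_m)(offset − M₀)` tends to `0`, so it is
eventually `> −1`. -/
theorem branch_repin (reg : QCDRegularisation Nf) (M₀ : ℝ) (mc : ℕ → ℝ)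
    (hmc : Tendsto mc atTop (𝓝 0)) (hoff : Tendsto (cornerOffset reg mc) atTop (𝓝 M₀))
    (haZ : Tendsto (fun k => reg.a k / reg.Zm k) atTop (𝓝 0)) :
    ∀ᶠ k in atTop, (-1 : ℝ) < (repin reg M₀).mcrit k := by
  have hD : Tendsto (fun k => cornerOffset reg mc k - M₀) atTop (𝓝 0) := by
    simpa using hoff.sub_const M₀
  have hlim : Tendsto (fun k => (repin reg M₀).mcrit k) atTop (𝓝 0) := by
    have h := hmc.add (haZ.mul hD)
    simp only [mul_zero, add_zero] at h
    refine h.congr (fun k => ?_)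
    exact (repin_mcrit_eq reg M₀ mc k).symm
  exact hlim.eventually_const_lt (by norm_num)

/-- **The heavy body of the re-pinned regularisation** above `M₁ + |M₀| + 1` (non-strict, the crux's form) from the
body of `reg` above `M₁` (strict): run `reg` at `m − M₀` (`scheme_repin`). -/
theorem body_repin (reg : QCDRegularisation Nf) (M₀ M₁ : ℝ) (hbody : BodyAbove reg M₁) :
    ∀ m : Fin Nf → ℝ, (∀ f, M₁ + |M₀| + 1 ≤ m f) →
      ∃ (z shift : QCDField Nf → ℕ → ℝ) (T : OSData (QCDField Nf) 4),
        IsQCDAlong ((repin reg M₀).scheme m z shift) T ∧ T.IsNontrivial QCDField.glue ∧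
          T.IsNonGaussian QCDField.glue ∧
            (∀ f g : Fin Nf, f ≠ g → T.IsNontrivial (QCDField.pseudoRe f g)) ∧
              ∃ Δ > 0, T.HasMassGap Δ ∧ ((repin reg M₀).scheme m z shift).HasLatticeMassGap Δ := by
  intro m hm
  have hm' : ∀ f, M₁ < m f - M₀ := fun f => by
    have h1 := hm f
    have h2 := le_abs_self M₀
    linarith
  obtain ⟨z, shift, T, hQ, hN, hG, hP, Δ, hΔ, hT, hL⟩ := hbody (fun f => m f - M₀) hm'
  refine ⟨z, shift, T, ?_, hN, hG, hP, Δ, hΔ, hT, ?_⟩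
  · rwa [scheme_repin]
  · rwa [scheme_repin]

/-! ## §4 Composition (kernel-checked): the crux BY NAME from the three stubs -/

/-- **THE CRUX FROM THE THREE STUBS** — concludes `Summit.QuantumFields.QCD.Theses.EulerDescent.HonestHeavyAnchor`
BY NAME.  Given `N_f ∈ {2,3}`: the unpinned anchor (S1) gives `M₁ ≥ 0`, a mass-scaling `reg` and its heavy body above
`M₁`; asymptotic scaling is read off the body at the tuple `M₁ + 1` (`IsQCDAlong`, first clause; it reads only
`β, a`); the corner law (S2) gives the intrinsic corner `mc` of `reg`'s couplings with `mc → 0`; the offset law (S3)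
gives the convergent offset `M₀`; and the RE-PINNED regularisation `repin reg M₀` with the SAME corner `mc` and the
threshold `M₁ + |M₀| + 1 > 0` witnesses the crux: corner, mass scaling and asymptotic scaling untouched
(definitional), pin `→ 0` (`pin_repin`), physical branch (`branch_repin` with `tendsto_a_div_Zm`,
`massExponent_nonneg`), heavy body transported (`body_repin`). -/
theorem HonestHeavyAnchor_of :
    Stmt.stub_heavyThresholdAnchor → Stmt.stub_intrinsicCorner → Stmt.stub_cornerOffset →
      HonestHeavyAnchor := by
  intro hA hC hO Nf hNf
  -- (S1) the unpinned heavy-threshold anchor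
  obtain ⟨M₁, hM₁, reg, hms, hbody⟩ := hA Nf hNf
  have hbody' : BodyAbove reg M₁ := hbody
  -- asymptotic scaling, read off the body at the tuple `M₁ + 1`
  have haf : (reg.scheme 0 0 0).HasAsymptoticScaling := by
    obtain ⟨z, shift, T, hqcd, -⟩ := hbody' (fun _ => M₁ + 1) (fun _ => lt_add_one M₁)
    exact (hasAsymptoticScaling_scheme_iff reg _ _ _ _ _ _).1 hqcd.1
  -- (S2) the intrinsic corner of `reg`'s couplings, closing in lattice units
  obtain ⟨mc, hcorner, hmc⟩ := hC Nf hNf reg haf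
  -- (S3) the convergent renormalised corner offset
  obtain ⟨M₀, hoff⟩ := hO Nf hNf reg mc M₁ hms hcorner hbody'
  -- the re-pinned regularisation witnesses the crux
  have hcorner' : IsCorner (repin reg M₀) mc := (isCorner_repin_iff reg M₀ mc).2 hcorner
  have hms' : (repin reg M₀).HasMassScaling := (hasMassScaling_repin_iff reg M₀).2 hms
  have haf' : ((repin reg M₀).scheme 0 0 0).HasAsymptoticScaling :=
    (hasAsymptoticScaling_repin_iff reg M₀ 0 0 0).2 haf
  have hbranch : ∀ᶠ k in atTop, (-1 : ℝ) < (repin reg M₀).mcrit k :=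
    branch_repin reg M₀ mc hmc hoff (tendsto_a_div_Zm reg hms (massExponent_nonneg hNf))
  have hMh : (0 : ℝ) < M₁ + |M₀| + 1 := by
    have h := abs_nonneg M₀
    linarith
  exact ⟨repin reg M₀, mc, M₁ + |M₀| + 1, hcorner', pin_repin reg M₀ mc hoff, hms', haf', hbranch, hMh,
    body_repin reg M₀ M₁ hbody'⟩

/-- The crux along this skeleton, from the registered stubs (sorries only inside `stub_*`). -/
theorem honestHeavyAnchor_of_stubs : HonestHeavyAnchor :=
  HonestHeavyAnchor_of stub_heavyThresholdAnchor stub_intrinsicCorner stub_cornerOffset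

end Summit.QuantumFields.QCD.Cruxes.HonestHeavyAnchor.Birth

end
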